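/-
Copyright (c) 2026 the pub-hodgecm-mathlib formalisation cell (harness21).  Prover seat hodgecm-mathlib-LH4-p11 (g8), req620 Track A «(D-RAM) FOUR-FRAME» squad, helper lane on
h413 = stmt-HodgeConjecture-24833 (count-neutral).  Dealer∕pen LH4-plan (g13) WORD #96 (2) «LH4-p11 OWNS THE PURE CELLS»; SIG-PureCells v1 (9a3f5135) §2 FILE 1a (per lattice).  2026-09-04.
-/
import Summits.HodgeConjecture.HodgeConjecture.Theorems.F0P3cDyRamLabelledOddOneSlotValueClass   -- ★ p860467 (F0P3-p01 (g36)) HEAD C `labelledOddCount_valueClassLabel_div_relIndex_eq_of_snd_small ∕ _of_fst_small`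
import Summits.HodgeConjecture.HodgeConjecture.Theorems.F0P3cDyRamDiagonalKappaSplitCountValues   -- ★ (LH4-p04): brings ★ `…KappaSplitCountEval` (explicit polarisations, `normSign_neg_polarisation_entry`), ★ B4 axis lattices, ★ level non-norm units
import HarnessLib

/-!
# Crux `H413`, line LH4 «(D-RAM) FOUR-FRAME» — (β-BAL) Stage B, THE PURE STRATA, FILE 1a: the labelled odd count PER LATTICE on the on-branch lattices `M₂(2j,y)`, `M₁(2j,z)`
# `labelledOddCount σ ϖ 0 i Λ M ∕ [𝒰 : N(S̃′(M))] = (ω(e_X) on the foot slot, 0 on the own slot, ω(−1)ω(e_X)·[d ≤ j] on the third)∕2 · stabiliserWeight σ M`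

Cell `hodgecm-mathlib` (D-0151), FLOOR 0, crux item H413 = `stmt-HodgeConjecture-24833`, route `HCCMUnconditional`; squad F0∕P3c∕LH4.  THEOREMS ONLY (no `def`, no instance, no
notation, no `sorry`, default heartbeats); ★-only imports; lane `--supports stmt-HodgeConjecture-24833 --as helper` (count-neutral); pays NO row, states NO law.

THE MATHEMATICS (SIG-PureCells v1 §0–§1; consumer LH4-p05 (g8)'s box assembler `table_of_box`).  On the on-branch lattice `M₂(2j, y) = latt (1 0 0; 0 1 0; y 0 ϖ^{2j})` (plane `⟨e₀,e₂⟩`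
at distance `2j`, `e₁` split off) the explicit type-0 polarisation is `D = (−yσy·π₀^{−j}, 1, π₀^{−j})` (★ LH4-p04), the slot-`1` term of the label form `D₁·x₁·N(w₁)` is `ϖ^{m*}`-small
as soon as `|x₁| ≤ |ϖ|^{m*}`, and ★ p860467 HEAD C reads the per-lattice value `ω(e′)ω(D_i)∕2·[ω_iω_0 ≡ 1 on S_F]·stabiliserWeight` with `e′ = −yσy·e_A`, `e_A` the σ-fixed unit of
the TOWER-SIGN TOKEN `|(ϖ^{m*})⁻¹(x₀·π₀^{−j} − e_A·t₊)| ≤ 1`.  The norm factors drop: `ω(e′)ω(D₀) = ω(e_A)`, `ω(e′)ω(D₂) = ω(−1)ω(e_A)`; `S_F = {u : |u₂ − u₀| ≤ |ϖ|^{2j}}` (★ B4) kills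
slot `1` by `(1, c, 1)` and makes slot `2` alive iff `d ≤ j` (★ deep norms ∕ ★ level non-norm unit) — so the value is `(ω(e_A), 0, ω(−1)ω(e_A)·[d ≤ j])_i ∕ 2 · stabiliserWeight`.
`M₁(2j,z)` is the same computation with slots `0 ↔ 1`, token `e_B`.  FILE 1b sums these over the strata `(s,0,s)`, `(0,s,s)` cut by the clean shell (LH4-p05 (g8)'s box currency).
HONEST LABEL.  Count-neutral helper; two of the per-stratum values of LH4-p05 (g8)'s box; the table identity (SIG-B2b3), (β-BAL), (β), T₊ remain OPEN; `HC_CM` is proved only modulo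
the 7 printed citations (2 remaining named inputs: hLiu418 = `stmt-HodgeConjecture-24832`, h413 = `stmt-HodgeConjecture-24833`) until rung 0 closes.

## References
* [Kottwitz1986BaseChangeUnits] R. E. Kottwitz, *Base change for unit elements of Hecke algebras*, Compositio Math. 60 (1986), §1 pp. 240–241.
* [Rogawski1990] J. D. Rogawski, *Automorphic Representations of Unitary Groups in Three Variables*, Ann. of Math. Stud. 123 (1990), §4.9 Prop. 4.9.1 (a)(b) p. 55, §4.10 p. 58.
* [LanglandsShelstad1987] R. P. Langlands, D. Shelstad, *On the definition of transfer factors*, Math. Ann. 278 (1987), §3.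
* [Serre1979] J.-P. Serre, *Local Fields*, GTM 67 (1979), Ch. V §3 Prop. 5, Cor. 3.
-/

set_option autoImplicit false

noncomputable section

namespace Summit.HodgeConjecture.HodgeConjecture.Cruxes.H413.F0P3cDyRamLabelledOddPureLatticeT

open Literature.NumberTheory.Automorphic Literature.NumberTheory.Automorphic.HermitianLattice
open Literature.NumberTheory.Automorphic.UnitaryLatticeTree Literature.NumberTheory.Automorphic.UnitaryThreeFourFrame
open Literature.NumberTheory.LocalFields Literature.NumberTheory.LocalFields.WildQuadraticDatum
open Summit.HodgeConjecture.HodgeConjecture.Cruxes.H413.F0P3cDyRamFourFramePieces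
open Summit.HodgeConjecture.HodgeConjecture.Cruxes.H413.F0P3cDyRamDiagonalTorusDefs
open Summit.HodgeConjecture.HodgeConjecture.Cruxes.H413.F0P3cDyRamLabelledOddCountDefs
open Summit.HodgeConjecture.HodgeConjecture.Cruxes.H413.F0P3cDyRamStableSumSignClasses (normSign_eq_one_or)
open Summit.HodgeConjecture.HodgeConjecture.Cruxes.H413.F0P3cDyRamFixedCountDiagonalModel (normSign_mul_norm)
open Summit.HodgeConjecture.HodgeConjecture.Cruxes.H413.F0P3cDyRamDiagonalSplitCountAxisOne
open Summit.HodgeConjecture.HodgeConjecture.Cruxes.H413.F0P3cDyRamDiagonalSplitCountAxisTwo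
open Summit.HodgeConjecture.HodgeConjecture.Cruxes.H413.F0P3cDyRamDiagonalKappaSplitCountEval
open Summit.HodgeConjecture.HodgeConjecture.Cruxes.H413.F0P3cDyRamLabelledOddOneSlotValueClass
open scoped Valued WithZero Matrix MatrixGroups

variable {K : Type} [Field K] [Valued K ℤᵐ⁰]

/-! ## §1  Per lattice: the value on the on-branch lattices `M₂(2j, y)` and `M₁(2j, z)` -/

section PerLattice

variable [CompleteSpace K] [Fintype 𝓀[K]] {σ : K →+* K} {ϖ : K} {d t : ℕ}

/-- **PER-LATTICE VALUE ON `M₂(2j,y)`** (`|y| = 1`; `|x₁| ≤ |ϖ|^{m*}`; `e_A` a σ-fixed unit with `|(ϖ^{m*})⁻¹(x₀·π₀^{−j} − e_A·t₊)| ≤ 1`):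
`labelledOddCount σ ϖ 0 i Λ M₂ ∕ [𝒰 : N(S̃′)] = (ω(e_A), 0, ω(−1)·ω(e_A)·[d ≤ j])_i ∕ 2 · stabiliserWeight σ M₂` for `Λ = valueClassLabel σ ϖ x₀ x₁ m* d` (★ p860467 HEAD C at the
explicit polarisation `(−yσy·π₀^{−j}, 1, π₀^{−j})`, `e′ = −yσy·e_A`; the stabiliser `|u₂ − u₀| ≤ |ϖ|^{2j}` of ★ B4). [cite: Kottwitz1986BaseChangeUnits, §1 pp. 240–241]
[cite: Rogawski1990, §4.9 Prop. 4.9.1 (a)(b) p. 55] [cite: Serre1979, Ch. V §3 Prop. 5, Cor. 3] -/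
theorem labelledOddCount_div_relIndex_latt_axis2 (hD : IsRamifiedQuadraticDatum σ ϖ d t) {y : K} (hy : Valued.v y = 1) (j : ℕ)
    (x₀ x₁ : K) (hx₁ : Valued.v x₁ ≤ Valued.v (ϖ ^ (d % 2 + 2 * d - 1)))
    {eA : K} (hσeA : σ eA = eA) (heA1 : Valued.v eA = 1)
    (heA : Valued.v ((ϖ ^ (d % 2 + 2 * d - 1))⁻¹ * (x₀ * ((ϖ * σ ϖ) ^ j)⁻¹ - eA * ((ϖ - σ ϖ) * ((ϖ * σ ϖ) ^ ((d - d % 2) / 2))⁻¹))) ≤ 1)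
    {M₀ : Submodule 𝒪[K] (Fin 3 → K)} (hM₀ : M₀ = latt (!![1, 0, 0; 0, 1, 0; y, 0, ϖ ^ (2 * j)] : Matrix (Fin 3) (Fin 3) K))
    (hfin : {M : Submodule 𝒪[K] (Fin 3 → K) | ∃ u ∈ unitTorus K 3, M = mapGL (diagGLUnits u) M₀}.Finite) (i : Fin 3) :
    (labelledOddCount σ ϖ 0 i (valueClassLabel σ ϖ x₀ x₁ (d % 2 + 2 * d - 1) d) M₀ : ℚ) /
        ((((unitStabilizer M₀).map (unitNormMap σ 3)).relIndex (fixedUnitTorus σ 3) : ℕ) : ℚ) =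
      ((if i = 0 then normSign σ eA else if i = 2 ∧ d ≤ j then normSign σ (-1 : K) * normSign σ eA else 0 : ℤ) : ℚ) / 2 * stabiliserWeight σ M₀ := by
  have hD' := hD
  obtain ⟨hσ, hvσ, hϖ, -, -, -, -⟩ := hD'
  haveI : IsAdicComplete 𝓂[K] 𝒪[K] := isAdicComplete_valuedInteger_of_completeSpace hϖ
  obtain ⟨c, hσc, hcv, hc, hdich⟩ := exists_nonnorm_dichotomy_of_isRamifiedQuadraticDatum σ ϖ d t hD
  have hϖ0 : ϖ ≠ 0 := fun h0 => by rw [h0, map_zero] at hϖ; exact WithZero.coe_ne_zero hϖ.symm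
  have hϖ1 : Valued.v ϖ ≤ 1 := by rw [hϖ, ← WithZero.exp_zero, WithZero.exp_le_exp]; norm_num
  have hσϖ0 : σ ϖ ≠ 0 := (map_ne_zero σ).2 hϖ0
  have hy0 : y ≠ 0 := fun h => by rw [h, map_zero] at hy; exact zero_ne_one hy
  have hc0 : c ≠ 0 := fun h => by rw [h, map_zero] at hcv; exact zero_ne_one hcv
  have heA0 : eA ≠ 0 := fun h => by rw [h, map_zero] at heA1; exact zero_ne_one heA1
  have hπ₀σ : σ (ϖ * σ ϖ) = ϖ * σ ϖ := by rw [map_mul, hσ, mul_comm]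
  have hd₁σ : σ (((ϖ * σ ϖ) ^ j)⁻¹) = ((ϖ * σ ϖ) ^ j)⁻¹ := by rw [map_inv₀, map_pow, hπ₀σ]
  have hπ0 : ((ϖ * σ ϖ) ^ j : K) ≠ 0 := pow_ne_zero _ (mul_ne_zero hϖ0 hσϖ0)
  have hd₁0 : (((ϖ * σ ϖ) ^ j)⁻¹ : K) ≠ 0 := inv_ne_zero hπ0
  -- the explicit polarisation of ★ LH4-p04
  have hD₁ : ∀ k : Fin 3, σ ((![-(σ y * ((ϖ * σ ϖ) ^ j)⁻¹ * y), 1, ((ϖ * σ ϖ) ^ j)⁻¹] : Fin 3 → K) k) =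
      (![-(σ y * ((ϖ * σ ϖ) ^ j)⁻¹ * y), 1, ((ϖ * σ ϖ) ^ j)⁻¹] : Fin 3 → K) k ∧ (![-(σ y * ((ϖ * σ ϖ) ^ j)⁻¹ * y), 1, ((ϖ * σ ϖ) ^ j)⁻¹] : Fin 3 → K) k ≠ 0 := by
    intro k
    fin_cases k
    · refine ⟨?_, ?_⟩
      · show σ (-(σ y * ((ϖ * σ ϖ) ^ j)⁻¹ * y)) = -(σ y * ((ϖ * σ ϖ) ^ j)⁻¹ * y)
        rw [map_neg, map_mul, map_mul, hσ, hd₁σ]; ring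
      · show -(σ y * ((ϖ * σ ϖ) ^ j)⁻¹ * y) ≠ 0
        exact neg_ne_zero.2 (mul_ne_zero (mul_ne_zero ((map_ne_zero σ).2 hy0) hd₁0) hy0)
    · exact ⟨map_one σ, one_ne_zero⟩
    · exact ⟨hd₁σ, hd₁0⟩
  have hV₁ := isVertexLattice_latt_axis2 hvσ hϖ hy j
  have hnorm := isNormalisedLattice_latt_axis2 hϖ1 hy (2 * j)
  rw [← hM₀] at hV₁ hnorm
  -- the slot-1 term is `ϖ^{m*}`-small (`D₁ = 1`, `|x₁| ≤ |ϖ|^{m*}`, `|w₁| ≤ 1`)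
  have hsmall : ∀ w ∈ M₀, Valued.v ((ϖ ^ (d % 2 + 2 * d - 1))⁻¹ *
      ((![-(σ y * ((ϖ * σ ϖ) ^ j)⁻¹ * y), 1, ((ϖ * σ ϖ) ^ j)⁻¹] : Fin 3 → K) 1 * x₁ * (w 1 * σ (w 1)))) ≤ 1 := by
    intro w hw
    have hw1 : Valued.v (w 1) ≤ 1 := (hnorm 1).1 w hw
    have hm0 : Valued.v (ϖ ^ (d % 2 + 2 * d - 1)) ≠ 0 := (Valuation.ne_zero_iff _).2 (pow_ne_zero _ hϖ0)
    have e1 : ((![-(σ y * ((ϖ * σ ϖ) ^ j)⁻¹ * y), 1, ((ϖ * σ ϖ) ^ j)⁻¹] : Fin 3 → K) 1) = 1 := rfl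
    rw [e1, one_mul, map_mul, map_inv₀, map_mul, map_mul, hvσ]
    calc (Valued.v (ϖ ^ (d % 2 + 2 * d - 1)))⁻¹ * (Valued.v x₁ * (Valued.v (w 1) * Valued.v (w 1)))
        ≤ (Valued.v (ϖ ^ (d % 2 + 2 * d - 1)))⁻¹ * (Valued.v (ϖ ^ (d % 2 + 2 * d - 1)) * (1 * 1)) := by
          gcongr
      _ = 1 := by rw [mul_one, mul_one, inv_mul_cancel₀ hm0]
  -- the head's `e′ = −yσy·e_A`
  have hσe' : σ (-(σ y * y) * eA) = -(σ y * y) * eA := by rw [map_mul, map_neg, map_mul, hσ, hσeA]; ring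
  have he'1 : Valued.v (-(σ y * y) * eA) = 1 := by rw [map_mul, Valuation.map_neg, map_mul, hvσ, hy, heA1]; norm_num
  have hee : Valued.v ((ϖ ^ (d % 2 + 2 * d - 1))⁻¹ *
      ((![-(σ y * ((ϖ * σ ϖ) ^ j)⁻¹ * y), 1, ((ϖ * σ ϖ) ^ j)⁻¹] : Fin 3 → K) 0 * x₀ -
        -(σ y * y) * eA * ((ϖ - σ ϖ) * ((ϖ * σ ϖ) ^ ((d - d % 2) / 2))⁻¹))) ≤ 1 := by
    have e0 : ((![-(σ y * ((ϖ * σ ϖ) ^ j)⁻¹ * y), 1, ((ϖ * σ ϖ) ^ j)⁻¹] : Fin 3 → K) 0) = -(σ y * ((ϖ * σ ϖ) ^ j)⁻¹ * y) := rfl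
    have e1 : (ϖ ^ (d % 2 + 2 * d - 1))⁻¹ * (-(σ y * ((ϖ * σ ϖ) ^ j)⁻¹ * y) * x₀ - -(σ y * y) * eA * ((ϖ - σ ϖ) * ((ϖ * σ ϖ) ^ ((d - d % 2) / 2))⁻¹)) =
        -(σ y * y) * ((ϖ ^ (d % 2 + 2 * d - 1))⁻¹ * (x₀ * ((ϖ * σ ϖ) ^ j)⁻¹ - eA * ((ϖ - σ ϖ) * ((ϖ * σ ϖ) ^ ((d - d % 2) / 2))⁻¹))) := by ring
    rw [e0, e1, map_mul, Valuation.map_neg, map_mul, hvσ, hy, one_mul, one_mul]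
    exact heA
  rw [labelledOddCount_valueClassLabel_div_relIndex_eq_of_snd_small hD hσc hcv hc hdich x₀ x₁
    (Matrix.GeneralLinearGroup.mkOfDetNeZero _ (det_axis2_ne_zero hϖ0 y (2 * j))) hM₀ hnorm hfin hD₁ hV₁ hsmall hσe' he'1 hee i]
  -- `ω(e′) = ω(−1)·ω(e_A)`
  have hωe' : normSign σ (-(σ y * y) * eA) = normSign σ (-1 : K) * normSign σ eA := by
    rw [show -(σ y * y) * eA = (-1 * eA) * (y * σ y) by ring, normSign_mul_norm σ _ hy0,
      normSign_mul_of_dichotomy σ hσc hc hdich (by rw [map_neg, map_one]) hσeA (neg_ne_zero.2 one_ne_zero) heA0]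
  have hωm1 : (normSign σ (-1 : K) : ℚ) * (normSign σ (-1 : K) : ℚ) = 1 := by exact_mod_cast normSign_mul_self σ (-1 : K)
  -- the stabiliser `S_F = {u : |u₂ − u₀| ≤ |ϖ|^{2j}}`
  have hSF : ∀ u : Fin 3 → Kˣ, u ∈ fixedUnitStabilizer σ M₀ ↔ u ∈ fixedUnitTorus σ 3 ∧ Valued.v ((u 2 : K) - u 0) ≤ Valued.v (ϖ ^ (2 * j)) := fun u => by
    rw [hM₀]; exact mem_fixedUnitStabilizer_latt_axis2_iff σ hϖ0 hy (2 * j) u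
  rw [hωe']
  by_cases hi0 : i = 0
  · subst hi0
    have hall : ∀ u ∈ fixedUnitStabilizer σ M₀, normSign σ ((u 0 : Kˣ) : K) * normSign σ ((u 0 : Kˣ) : K) = 1 := fun u _ => normSign_mul_self σ _
    have e0 : normSign σ ((![-(σ y * ((ϖ * σ ϖ) ^ j)⁻¹ * y), 1, ((ϖ * σ ϖ) ^ j)⁻¹] : Fin 3 → K) 0) = normSign σ (-1 : K) :=
      normSign_neg_polarisation_entry hϖ0 hy0 j
    rw [if_pos hall, if_pos rfl, e0]
    push_cast
    linear_combination ((normSign σ eA : ℚ) / 2 * stabiliserWeight σ M₀) * hωm1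
  by_cases hi2 : i = 2
  · subst hi2
    have e2 : normSign σ ((![-(σ y * ((ϖ * σ ϖ) ^ j)⁻¹ * y), 1, ((ϖ * σ ϖ) ^ j)⁻¹] : Fin 3 → K) 2) = 1 := normSign_normVarpi_pow_inv hϖ0 j
    rw [e2]
    by_cases hdj : d ≤ j
    · -- ALIVE: `u₂∕u₀ ∈ U_F^{(j)}`, `j ≥ d` ⇒ `ω(u₂) = ω(u₀)`
      have hall : ∀ u ∈ fixedUnitStabilizer σ M₀, normSign σ ((u 2 : Kˣ) : K) * normSign σ ((u 0 : Kˣ) : K) = 1 := by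
        intro u hu
        obtain ⟨huT, h20⟩ := (hSF u).1 hu
        obtain ⟨huv, huσ⟩ := (mem_fixedUnitTorus_iff σ u).1 huT
        have hle : Valued.v (((u 0 : Kˣ) : K) - (u 2 : Kˣ)) ≤ Valued.v ϖ ^ (2 * d) := by
          rw [Valuation.map_sub_swap]
          exact h20.trans (by rw [map_pow]; exact (UnitaryLatticeTree.v_pow_le_v_pow_iff hϖ _ _).2 (by omega))
        rw [normSign_eq_of_near hD (huσ 0) (huσ 2) (huv 0) (n := 2 * d) (by omega) hle, normSign_mul_self]
      rw [if_pos hall, if_neg (show (2 : Fin 3) ≠ 0 by decide), if_pos ⟨rfl, hdj⟩]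
      push_cast; ring
    · -- DEAD: the level-`j` non-norm `u₀` gives `(1, 1, u₀) ∈ S_F` with `ω(u₂)ω(u₀) = ω(u₀) = −1`
      obtain ⟨u₀, hσu₀, hu₀1, hu₀, hu₀n⟩ := exists_fixed_unit_not_norm_of_level_pow σ ϖ d t hD (n := j) (by omega)
      have hu₀0 : u₀ ≠ 0 := fun h => by rw [h, map_zero] at hu₀1; exact zero_ne_one hu₀1
      have hnall : ¬ ∀ u ∈ fixedUnitStabilizer σ M₀, normSign σ ((u 2 : Kˣ) : K) * normSign σ ((u 0 : Kˣ) : K) = 1 := by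
        intro hall
        have hmem : (![1, 1, Units.mk0 u₀ hu₀0] : Fin 3 → Kˣ) ∈ fixedUnitStabilizer σ M₀ := by
          refine (hSF _).2 ⟨(mem_fixedUnitTorus_iff σ _).2 ⟨fun k => ?_, fun k => ?_⟩, ?_⟩
          · fin_cases k <;> simp [hu₀1]
          · fin_cases k <;> simp [hσu₀]
          · simpa using hu₀
        have h := hall _ hmem
        simp only [Matrix.cons_val_two, Matrix.tail_cons, Matrix.head_cons, Matrix.cons_val_zero, Units.val_one, Units.val_mk0,
          normSign_one, normSign_of_not_isNorm σ hu₀n] at h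
        norm_num at h
      rw [if_neg hnall, if_neg (show (2 : Fin 3) ≠ 0 by decide), if_neg (fun h => hdj h.2)]
      push_cast; ring
  · -- the own slot `i = 1`: `(1, c, 1) ∈ S_F` with `ω(u₁)ω(u₀) = ω(c) = −1`
    obtain rfl : i = 1 := by
      fin_cases i
      · exact absurd rfl hi0
      · rfl
      · exact absurd rfl hi2
    have hnall : ¬ ∀ u ∈ fixedUnitStabilizer σ M₀, normSign σ ((u 1 : Kˣ) : K) * normSign σ ((u 0 : Kˣ) : K) = 1 := by
      intro hall
      have hmem : (![1, Units.mk0 c hc0, 1] : Fin 3 → Kˣ) ∈ fixedUnitStabilizer σ M₀ := by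
        refine (hSF _).2 ⟨(mem_fixedUnitTorus_iff σ _).2 ⟨fun k => ?_, fun k => ?_⟩, ?_⟩
        · fin_cases k <;> simp [hcv]
        · fin_cases k <;> simp [hσc]
        · simp
      have h := hall _ hmem
      simp only [Matrix.cons_val_one, Matrix.cons_val_zero, Units.val_one, Units.val_mk0, normSign_one,
        normSign_of_not_isNorm σ hc] at h
      norm_num at h
    rw [if_neg hnall, if_neg (show (1 : Fin 3) ≠ 0 by decide), if_neg (fun h => absurd h.1 (by decide))]
    push_cast; ring

/-- **PER-LATTICE VALUE ON `M₁(2j,z)`** (`|z| = 1`; `|x₀| ≤ |ϖ|^{m*}`; `e_B` a σ-fixed unit with `|(ϖ^{m*})⁻¹(x₁·π₀^{−j} − e_B·t₊)| ≤ 1`):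
`labelledOddCount σ ϖ 0 i Λ M₁ ∕ [𝒰 : N(S̃′)] = (0, ω(e_B), ω(−1)·ω(e_B)·[d ≤ j])_i ∕ 2 · stabiliserWeight σ M₁` (★ p860467 HEAD C read on slot `1` at the explicit polarisation
`(1, −zσz·π₀^{−j}, π₀^{−j})`; the stabiliser `|u₂ − u₁| ≤ |ϖ|^{2j}` of ★ B4). [cite: Kottwitz1986BaseChangeUnits, §1 pp. 240–241] [cite: Rogawski1990, §4.9 Prop. 4.9.1 (a)(b) p. 55]
[cite: Serre1979, Ch. V §3 Prop. 5, Cor. 3] -/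
theorem labelledOddCount_div_relIndex_latt_axis1 (hD : IsRamifiedQuadraticDatum σ ϖ d t) {z : K} (hz : Valued.v z = 1) (j : ℕ)
    (x₀ x₁ : K) (hx₀ : Valued.v x₀ ≤ Valued.v (ϖ ^ (d % 2 + 2 * d - 1)))
    {eB : K} (hσeB : σ eB = eB) (heB1 : Valued.v eB = 1)
    (heB : Valued.v ((ϖ ^ (d % 2 + 2 * d - 1))⁻¹ * (x₁ * ((ϖ * σ ϖ) ^ j)⁻¹ - eB * ((ϖ - σ ϖ) * ((ϖ * σ ϖ) ^ ((d - d % 2) / 2))⁻¹))) ≤ 1)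
    {M₀ : Submodule 𝒪[K] (Fin 3 → K)} (hM₀ : M₀ = latt (!![1, 0, 0; 0, 1, 0; 0, z, ϖ ^ (2 * j)] : Matrix (Fin 3) (Fin 3) K))
    (hfin : {M : Submodule 𝒪[K] (Fin 3 → K) | ∃ u ∈ unitTorus K 3, M = mapGL (diagGLUnits u) M₀}.Finite) (i : Fin 3) :
    (labelledOddCount σ ϖ 0 i (valueClassLabel σ ϖ x₀ x₁ (d % 2 + 2 * d - 1) d) M₀ : ℚ) /
        ((((unitStabilizer M₀).map (unitNormMap σ 3)).relIndex (fixedUnitTorus σ 3) : ℕ) : ℚ) =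
      ((if i = 1 then normSign σ eB else if i = 2 ∧ d ≤ j then normSign σ (-1 : K) * normSign σ eB else 0 : ℤ) : ℚ) / 2 * stabiliserWeight σ M₀ := by
  have hD' := hD
  obtain ⟨hσ, hvσ, hϖ, -, -, -, -⟩ := hD'
  haveI : IsAdicComplete 𝓂[K] 𝒪[K] := isAdicComplete_valuedInteger_of_completeSpace hϖ
  obtain ⟨c, hσc, hcv, hc, hdich⟩ := exists_nonnorm_dichotomy_of_isRamifiedQuadraticDatum σ ϖ d t hD
  have hϖ0 : ϖ ≠ 0 := fun h0 => by rw [h0, map_zero] at hϖ; exact WithZero.coe_ne_zero hϖ.symm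
  have hϖ1 : Valued.v ϖ ≤ 1 := by rw [hϖ, ← WithZero.exp_zero, WithZero.exp_le_exp]; norm_num
  have hσϖ0 : σ ϖ ≠ 0 := (map_ne_zero σ).2 hϖ0
  have hz0 : z ≠ 0 := fun h => by rw [h, map_zero] at hz; exact zero_ne_one hz
  have hc0 : c ≠ 0 := fun h => by rw [h, map_zero] at hcv; exact zero_ne_one hcv
  have heB0 : eB ≠ 0 := fun h => by rw [h, map_zero] at heB1; exact zero_ne_one heB1
  have hπ₀σ : σ (ϖ * σ ϖ) = ϖ * σ ϖ := by rw [map_mul, hσ, mul_comm]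
  have hd₁σ : σ (((ϖ * σ ϖ) ^ j)⁻¹) = ((ϖ * σ ϖ) ^ j)⁻¹ := by rw [map_inv₀, map_pow, hπ₀σ]
  have hπ0 : ((ϖ * σ ϖ) ^ j : K) ≠ 0 := pow_ne_zero _ (mul_ne_zero hϖ0 hσϖ0)
  have hd₁0 : (((ϖ * σ ϖ) ^ j)⁻¹ : K) ≠ 0 := inv_ne_zero hπ0
  have hD₁ : ∀ k : Fin 3, σ ((![1, -(σ z * ((ϖ * σ ϖ) ^ j)⁻¹ * z), ((ϖ * σ ϖ) ^ j)⁻¹] : Fin 3 → K) k) =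
      (![1, -(σ z * ((ϖ * σ ϖ) ^ j)⁻¹ * z), ((ϖ * σ ϖ) ^ j)⁻¹] : Fin 3 → K) k ∧ (![1, -(σ z * ((ϖ * σ ϖ) ^ j)⁻¹ * z), ((ϖ * σ ϖ) ^ j)⁻¹] : Fin 3 → K) k ≠ 0 := by
    intro k
    fin_cases k
    · exact ⟨map_one σ, one_ne_zero⟩
    · refine ⟨?_, ?_⟩
      · show σ (-(σ z * ((ϖ * σ ϖ) ^ j)⁻¹ * z)) = -(σ z * ((ϖ * σ ϖ) ^ j)⁻¹ * z)
        rw [map_neg, map_mul, map_mul, hσ, hd₁σ]; ring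
      · show -(σ z * ((ϖ * σ ϖ) ^ j)⁻¹ * z) ≠ 0
        exact neg_ne_zero.2 (mul_ne_zero (mul_ne_zero ((map_ne_zero σ).2 hz0) hd₁0) hz0)
    · exact ⟨hd₁σ, hd₁0⟩
  have hV₁ := isVertexLattice_latt_axis1 hvσ hϖ hz j
  have hnorm := isNormalisedLattice_latt_axis1 hϖ1 hz (2 * j)
  rw [← hM₀] at hV₁ hnorm
  -- the slot-0 term is `ϖ^{m*}`-small (`D₀ = 1`, `|x₀| ≤ |ϖ|^{m*}`, `|w₀| ≤ 1`)
  have hsmall : ∀ w ∈ M₀, Valued.v ((ϖ ^ (d % 2 + 2 * d - 1))⁻¹ *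
      ((![1, -(σ z * ((ϖ * σ ϖ) ^ j)⁻¹ * z), ((ϖ * σ ϖ) ^ j)⁻¹] : Fin 3 → K) 0 * x₀ * (w 0 * σ (w 0)))) ≤ 1 := by
    intro w hw
    have hw0 : Valued.v (w 0) ≤ 1 := (hnorm 0).1 w hw
    have hm0 : Valued.v (ϖ ^ (d % 2 + 2 * d - 1)) ≠ 0 := (Valuation.ne_zero_iff _).2 (pow_ne_zero _ hϖ0)
    have e1 : ((![1, -(σ z * ((ϖ * σ ϖ) ^ j)⁻¹ * z), ((ϖ * σ ϖ) ^ j)⁻¹] : Fin 3 → K) 0) = 1 := rfl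
    rw [e1, one_mul, map_mul, map_inv₀, map_mul, map_mul, hvσ]
    calc (Valued.v (ϖ ^ (d % 2 + 2 * d - 1)))⁻¹ * (Valued.v x₀ * (Valued.v (w 0) * Valued.v (w 0)))
        ≤ (Valued.v (ϖ ^ (d % 2 + 2 * d - 1)))⁻¹ * (Valued.v (ϖ ^ (d % 2 + 2 * d - 1)) * (1 * 1)) := by
          gcongr
      _ = 1 := by rw [mul_one, mul_one, inv_mul_cancel₀ hm0]
  have hσe' : σ (-(σ z * z) * eB) = -(σ z * z) * eB := by rw [map_mul, map_neg, map_mul, hσ, hσeB]; ring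
  have he'1 : Valued.v (-(σ z * z) * eB) = 1 := by rw [map_mul, Valuation.map_neg, map_mul, hvσ, hz, heB1]; norm_num
  have hee : Valued.v ((ϖ ^ (d % 2 + 2 * d - 1))⁻¹ *
      ((![1, -(σ z * ((ϖ * σ ϖ) ^ j)⁻¹ * z), ((ϖ * σ ϖ) ^ j)⁻¹] : Fin 3 → K) 1 * x₁ -
        -(σ z * z) * eB * ((ϖ - σ ϖ) * ((ϖ * σ ϖ) ^ ((d - d % 2) / 2))⁻¹))) ≤ 1 := by
    have e0 : ((![1, -(σ z * ((ϖ * σ ϖ) ^ j)⁻¹ * z), ((ϖ * σ ϖ) ^ j)⁻¹] : Fin 3 → K) 1) = -(σ z * ((ϖ * σ ϖ) ^ j)⁻¹ * z) := rfl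
    have e1 : (ϖ ^ (d % 2 + 2 * d - 1))⁻¹ * (-(σ z * ((ϖ * σ ϖ) ^ j)⁻¹ * z) * x₁ - -(σ z * z) * eB * ((ϖ - σ ϖ) * ((ϖ * σ ϖ) ^ ((d - d % 2) / 2))⁻¹)) =
        -(σ z * z) * ((ϖ ^ (d % 2 + 2 * d - 1))⁻¹ * (x₁ * ((ϖ * σ ϖ) ^ j)⁻¹ - eB * ((ϖ - σ ϖ) * ((ϖ * σ ϖ) ^ ((d - d % 2) / 2))⁻¹))) := by ring
    rw [e0, e1, map_mul, Valuation.map_neg, map_mul, hvσ, hz, one_mul, one_mul]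
    exact heB
  rw [labelledOddCount_valueClassLabel_div_relIndex_eq_of_fst_small hD hσc hcv hc hdich x₀ x₁
    (Matrix.GeneralLinearGroup.mkOfDetNeZero _ (det_axis1_ne_zero hϖ0 z (2 * j))) hM₀ hnorm hfin hD₁ hV₁ hsmall hσe' he'1 hee i]
  have hωe' : normSign σ (-(σ z * z) * eB) = normSign σ (-1 : K) * normSign σ eB := by
    rw [show -(σ z * z) * eB = (-1 * eB) * (z * σ z) by ring, normSign_mul_norm σ _ hz0,
      normSign_mul_of_dichotomy σ hσc hc hdich (by rw [map_neg, map_one]) hσeB (neg_ne_zero.2 one_ne_zero) heB0]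
  have hωm1 : (normSign σ (-1 : K) : ℚ) * (normSign σ (-1 : K) : ℚ) = 1 := by exact_mod_cast normSign_mul_self σ (-1 : K)
  have hSF : ∀ u : Fin 3 → Kˣ, u ∈ fixedUnitStabilizer σ M₀ ↔ u ∈ fixedUnitTorus σ 3 ∧ Valued.v ((u 2 : K) - u 1) ≤ Valued.v (ϖ ^ (2 * j)) := fun u => by
    rw [hM₀]; exact mem_fixedUnitStabilizer_latt_axis1_iff σ hϖ0 hz (2 * j) u
  rw [hωe']
  by_cases hi1 : i = 1
  · subst hi1
    have hall : ∀ u ∈ fixedUnitStabilizer σ M₀, normSign σ ((u 1 : Kˣ) : K) * normSign σ ((u 1 : Kˣ) : K) = 1 := fun u _ => normSign_mul_self σ _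
    have e0 : normSign σ ((![1, -(σ z * ((ϖ * σ ϖ) ^ j)⁻¹ * z), ((ϖ * σ ϖ) ^ j)⁻¹] : Fin 3 → K) 1) = normSign σ (-1 : K) :=
      normSign_neg_polarisation_entry hϖ0 hz0 j
    rw [if_pos hall, if_pos rfl, e0]
    push_cast
    linear_combination ((normSign σ eB : ℚ) / 2 * stabiliserWeight σ M₀) * hωm1
  by_cases hi2 : i = 2
  · subst hi2
    have e2 : normSign σ ((![1, -(σ z * ((ϖ * σ ϖ) ^ j)⁻¹ * z), ((ϖ * σ ϖ) ^ j)⁻¹] : Fin 3 → K) 2) = 1 := normSign_normVarpi_pow_inv hϖ0 j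
    rw [e2]
    by_cases hdj : d ≤ j
    · have hall : ∀ u ∈ fixedUnitStabilizer σ M₀, normSign σ ((u 2 : Kˣ) : K) * normSign σ ((u 1 : Kˣ) : K) = 1 := by
        intro u hu
        obtain ⟨huT, h21⟩ := (hSF u).1 hu
        obtain ⟨huv, huσ⟩ := (mem_fixedUnitTorus_iff σ u).1 huT
        have hle : Valued.v (((u 1 : Kˣ) : K) - (u 2 : Kˣ)) ≤ Valued.v ϖ ^ (2 * d) := by
          rw [Valuation.map_sub_swap]
          exact h21.trans (by rw [map_pow]; exact (UnitaryLatticeTree.v_pow_le_v_pow_iff hϖ _ _).2 (by omega))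
        rw [normSign_eq_of_near hD (huσ 1) (huσ 2) (huv 1) (n := 2 * d) (by omega) hle, normSign_mul_self]
      rw [if_pos hall, if_neg (show (2 : Fin 3) ≠ 1 by decide), if_pos ⟨rfl, hdj⟩]
      push_cast; ring
    · obtain ⟨u₀, hσu₀, hu₀1, hu₀, hu₀n⟩ := exists_fixed_unit_not_norm_of_level_pow σ ϖ d t hD (n := j) (by omega)
      have hu₀0 : u₀ ≠ 0 := fun h => by rw [h, map_zero] at hu₀1; exact zero_ne_one hu₀1
      have hnall : ¬ ∀ u ∈ fixedUnitStabilizer σ M₀, normSign σ ((u 2 : Kˣ) : K) * normSign σ ((u 1 : Kˣ) : K) = 1 := by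
        intro hall
        have hmem : (![1, 1, Units.mk0 u₀ hu₀0] : Fin 3 → Kˣ) ∈ fixedUnitStabilizer σ M₀ := by
          refine (hSF _).2 ⟨(mem_fixedUnitTorus_iff σ _).2 ⟨fun k => ?_, fun k => ?_⟩, ?_⟩
          · fin_cases k <;> simp [hu₀1]
          · fin_cases k <;> simp [hσu₀]
          · simpa using hu₀
        have h := hall _ hmem
        simp only [Matrix.cons_val_two, Matrix.tail_cons, Matrix.head_cons, Matrix.cons_val_one, Matrix.cons_val_zero, Units.val_one,
          Units.val_mk0, normSign_one, normSign_of_not_isNorm σ hu₀n] at h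
        norm_num at h
      rw [if_neg hnall, if_neg (show (2 : Fin 3) ≠ 1 by decide), if_neg (fun h => hdj h.2)]
      push_cast; ring
  · -- the own slot `i = 0`: `(c, 1, 1) ∈ S_F` with `ω(u₀)ω(u₁) = ω(c) = −1`
    obtain rfl : i = 0 := by
      fin_cases i
      · rfl
      · exact absurd rfl hi1
      · exact absurd rfl hi2
    have hnall : ¬ ∀ u ∈ fixedUnitStabilizer σ M₀, normSign σ ((u 0 : Kˣ) : K) * normSign σ ((u 1 : Kˣ) : K) = 1 := by
      intro hall
      have hmem : (![Units.mk0 c hc0, 1, 1] : Fin 3 → Kˣ) ∈ fixedUnitStabilizer σ M₀ := by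
        refine (hSF _).2 ⟨(mem_fixedUnitTorus_iff σ _).2 ⟨fun k => ?_, fun k => ?_⟩, ?_⟩
        · fin_cases k <;> simp [hcv]
        · fin_cases k <;> simp [hσc]
        · simp
      have h := hall _ hmem
      simp only [Matrix.cons_val_one, Matrix.cons_val_zero, Units.val_one, Units.val_mk0, normSign_one,
        normSign_of_not_isNorm σ hc] at h
      norm_num at h
    rw [if_neg hnall, if_neg (show (0 : Fin 3) ≠ 1 by decide), if_neg (fun h => absurd h.1 (by decide))]
    push_cast; ring

end PerLattice

end Summit.HodgeConjecture.HodgeConjecture.Cruxes.H413.F0P3cDyRamLabelledOddPureLatticeT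

end
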